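import Mathlib
import Literature.NumberTheory.LFunctions.ExplicitFormulaPsiCharZeros
import Literature.NumberTheory.LFunctions.ExplicitFormulaPsiCharHeights
import Literature.NumberTheory.Sieve.HeathBrownCubicLeadingB
import Summits.ValiantsHypothesis.ValiantsHypothesis.Theorems.LiouvilleSarnakAlignedTypeICharactersMod2nBilinearSieveLinnikRange
import HarnessLib

/-!
# Route LiouvilleSarnak — support `AlignedTypeI` (stmt-ValiantsHypothesis-21040), line `characters_mod_2n`:
# tools for the zero-free-region input (zero counts in a box, zeros away from `Re s = 0`, the zero sum between two points)

Bookkeeping over the tree's PROVED explicit-formula apparatus (MV I Thm 10.17 unit windows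
`ExplicitPsiChar.exists_sum_window_le`, the reflection `ρ ↦ 1 − ρ` of MV Cor. 10.8 `ExplicitPsiChar.LFunction_one_sub_eq_zero_iff`,
no exceptional zero mod `2^j` `realZero_le_twoPower`), used by `…BilinearSieveZeroFreeInput.lean`:

* `sum_zeroOrder_box_le` — `N(T, χ) ≤ C₀ (T + 1)(log q + log(T + 5))` for primitive `χ` mod `q > 1`, `T ≥ 2` (the tree's
  `exists_boxCount_le` is the case `q ≤ T`);
* `re_ge_of_LFunction_eq_zero_twoPower` — non-trivial zeros of primitive `χ (mod 2^j)` have `Re ρ ≥ κ₁/(log 2^j + log(|Im ρ| + 4))`;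
* `norm_charZeroSumTrunc_sub_le` — `‖Σ_{|γ|≤T} m(ρ)(x^ρ − y^ρ)/ρ‖ ≤ (2M/β₀) N(T, χ)` when `Re ρ ≥ β₀`, `x^{Re ρ} ≤ M`;
* numerics `log_cube_add_five_le` (with the tree's `CubicSieve.log_six_le_two`), and the split `sum_primes_Iic_split` of the primes `≤ t` at `2`.

HONEST FRAMING. Helper lemmas only; the leaf `AlignedTypeI` is NOT closed here; nothing bears on `VP ≠ VNP` (NOT proved).
-/

set_option linter.dupNamespace false

noncomputable section

namespace Summit.ValiantsHypothesis.ValiantsHypothesis.Theorems.LiouvilleSarnak.AlignedTypeI.CharactersModTwoN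

open Finset ArithmeticFunction
open scoped BigOperators
open Literature.NumberTheory.LFunctions

/-- **`N(T, χ) ≪ (T + 1) log(q(T + 5))`**: for primitive `χ` mod `q > 1`, `T ≥ 2` and any finite set `P` of non-trivial zeros
with `|Im ρ| ≤ T`, `Σ_{ρ ∈ P} m(ρ) ≤ C₀ (T + 1)(log q + log(T + 5))` (MV Thm 10.17 summed over the unit windows centred at
the integers `|i| ≤ ⌊T⌋ + 1`; the tree's `exists_boxCount_le` is the case `q ≤ T`). [cite: MontgomeryVaughan2007, Theorem 10.17] -/
theorem sum_zeroOrder_box_le :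
    ∃ C₀ : ℝ, 0 < C₀ ∧ ∀ (q : ℕ) [NeZero q] (χ : DirichletCharacter ℂ q), χ.IsPrimitive → 1 < q →
      ∀ T : ℝ, 2 ≤ T → ∀ P : Finset ℂ, (∀ ρ ∈ P, ρ ∈ lfunctionZeroBox χ T) →
        ∑ ρ ∈ P, (DirichletDisc.zeroOrder χ ρ : ℝ) ≤ C₀ * (T + 1) * (Real.log q + Real.log (T + 5)) := by
  obtain ⟨C, hC0, hC⟩ := ExplicitPsiChar.exists_sum_window_le
  refine ⟨3 * C, by positivity, fun q _ χ hprim hq T hT P hP => ?_⟩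
  classical
  have hT0 : 0 < T := by linarith
  have hq1 : (1 : ℝ) < q := by exact_mod_cast hq
  have hlogq : 0 ≤ Real.log q := Real.log_nonneg hq1.le
  have hlogT5 : 0 ≤ Real.log (T + 5) := Real.log_nonneg (by linarith)
  set N : ℕ := ⌊T⌋₊ + 1 with hN
  have hNT : (N : ℝ) ≤ T + 1 := by
    rw [hN]; push_cast; linarith [Nat.floor_le hT0.le]
  have hTN : T < N := by rw [hN]; push_cast; exact Nat.lt_floor_add_one T
  set jw : ℂ → ℤ := fun ρ => ⌊ρ.im + 1 / 2⌋ with hj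
  set t : Finset ℤ := Finset.Icc (-(N : ℤ)) N with ht
  have hmaps : ∀ ρ ∈ P, jw ρ ∈ t := by
    intro ρ hρ
    obtain ⟨-, -, -, him⟩ := (mem_lfunctionZeroBox).1 (hP ρ hρ)
    rw [abs_le] at him
    rw [ht, Finset.mem_Icc, hj]
    constructor
    · rw [Int.le_floor]; push_cast; linarith
    · rw [Int.floor_le_iff]; push_cast; linarith
  rw [← Finset.sum_fiberwise_of_maps_to hmaps]
  have hwin : ∀ i ∈ t, ∑ ρ ∈ P with jw ρ = i, (DirichletDisc.zeroOrder χ ρ : ℝ) ≤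
      C * (Real.log q + Real.log (T + 5)) := by
    intro i hi
    rw [ht, Finset.mem_Icc] at hi
    have hiabs : |(i : ℝ)| ≤ T + 1 := by
      rw [abs_le]
      have h1 : (-(N : ℤ) : ℝ) ≤ (i : ℝ) := by exact_mod_cast hi.1
      have h2 : ((i : ℤ) : ℝ) ≤ (N : ℝ) := by exact_mod_cast hi.2
      push_cast at h1
      constructor <;> linarith
    have h := hC q χ hprim hq (i : ℝ) (P.filter fun ρ => jw ρ = i) (by
      intro ρ hρ
      rw [Finset.mem_filter] at hρ
      obtain ⟨h0, h1, h2, -⟩ := (mem_lfunctionZeroBox).1 (hP ρ hρ.1)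
      refine ⟨h0, h1, h2, ?_⟩
      have hfl : (i : ℝ) ≤ ρ.im + 1 / 2 ∧ ρ.im + 1 / 2 < i + 1 := by
        have := hρ.2
        rw [hj] at this
        dsimp only at this
        rw [← this]
        exact ⟨Int.floor_le _, Int.lt_floor_add_one _⟩
      rw [abs_le]
      constructor <;> linarith [hfl.1, hfl.2])
    refine h.trans ?_
    have hli : Real.log (|(i : ℝ)| + 4) ≤ Real.log (T + 5) :=
      Real.log_le_log (by positivity) (by linarith)
    exact mul_le_mul_of_nonneg_left (by linarith) hC0.le
  have hpos : 0 ≤ C * (Real.log q + Real.log (T + 5)) := mul_nonneg hC0.le (add_nonneg hlogq hlogT5)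
  calc ∑ i ∈ t, ∑ ρ ∈ P with jw ρ = i, (DirichletDisc.zeroOrder χ ρ : ℝ)
      ≤ ∑ i ∈ t, C * (Real.log q + Real.log (T + 5)) := Finset.sum_le_sum hwin
    _ = (t.card : ℝ) * (C * (Real.log q + Real.log (T + 5))) := by rw [Finset.sum_const, nsmul_eq_mul]
    _ ≤ (3 * (T + 1)) * (C * (Real.log q + Real.log (T + 5))) := by
        refine mul_le_mul_of_nonneg_right ?_ hpos
        have hcard : (t.card : ℝ) = 2 * N + 1 := by
          rw [ht, Int.card_Icc]
          have : ((N : ℤ) + 1 - -(N : ℤ)).toNat = 2 * N + 1 := by omega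
          rw [this]; push_cast; ring
        rw [hcard]; linarith
    _ = 3 * C * (T + 1) * (Real.log q + Real.log (T + 5)) := by ring

/-- **Non-trivial zeros of primitive `χ (mod 2^j)` stay away from the line `Re s = 0`**: there is an absolute `κ₁ > 0` with
`Re ρ ≥ κ₁/(log 2^j + log(|Im ρ| + 4))` for every zero `0 < Re ρ < 1` of `L(s, χ)`, `χ` primitive mod `2^j`, `j ≥ 1`
(`1 − ρ` is a zero of `L(s, χ̄)`, MV Cor. 10.8; apply the classical region MV Thm 11.3 to `χ̄`, and `realZero_le_twoPower`
if `χ̄` is quadratic with `1 − ρ` real). [folklore] -/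
theorem re_ge_of_LFunction_eq_zero_twoPower :
    ∃ κ₁ : ℝ, 0 < κ₁ ∧ ∀ (j : ℕ), 1 ≤ j → ∀ χ : DirichletCharacter ℂ (2 ^ j), χ.IsPrimitive → ∀ ρ : ℂ,
      χ.LFunction ρ = 0 → 0 < ρ.re → ρ.re < 1 →
        κ₁ / (Real.log ((2 : ℝ) ^ j) + Real.log (|ρ.im| + 4)) ≤ ρ.re := by
  obtain ⟨c, hc, hZ⟩ := Literature.NumberTheory.LFunctions.DirichletZFR.exists_zeroFree
  obtain ⟨κ, hκ, hR⟩ := realZero_le_twoPower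
  refine ⟨min c κ, lt_min hc hκ, fun j hj χ hχ ρ hρ h0 h1 => ?_⟩
  haveI : NeZero (2 ^ j) := ⟨pow_ne_zero _ two_ne_zero⟩
  have hq1 : 1 < 2 ^ j := Nat.one_lt_two_pow (by omega)
  have hne : χ ≠ 1 := ExplicitPsiChar.ne_one_of_isPrimitive hχ hq1
  have hne' : χ⁻¹ ≠ 1 := inv_ne_one.mpr hne
  -- `1 - ρ` is a zero of `L(s, χ⁻¹)`
  have h1ρ : χ⁻¹.LFunction (1 - ρ) = 0 := by
    have h0' : 0 < (1 - ρ).re := by simp; linarith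
    have h1' : (1 - ρ).re < 1 := by simp; linarith
    have key := (ExplicitPsiChar.LFunction_one_sub_eq_zero_iff hχ hne h0' h1').mp
    rw [sub_sub_cancel] at key
    exact key hρ
  have hcast : ((2 ^ j : ℕ) : ℝ) = (2 : ℝ) ^ j := by norm_num
  have hlog2j : 0 ≤ Real.log ((2 : ℝ) ^ j) := Real.log_nonneg (one_le_pow₀ (by norm_num))
  have habs : 0 ≤ |ρ.im| := abs_nonneg _
  have hlog4 : 0 < Real.log (|ρ.im| + 4) := Real.log_pos (by linarith)
  have hL0 : 0 < Real.log ((2 : ℝ) ^ j) + Real.log (|ρ.im| + 4) := by linarith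
  have hlog4le : Real.log 4 ≤ Real.log (|ρ.im| + 4) := Real.log_le_log (by norm_num) (by linarith)
  have hlog4pos : 0 < Real.log 4 := Real.log_pos (by norm_num)
  have hre1 : (1 - ρ).re = 1 - ρ.re := by simp
  have him1 : (1 - ρ).im = -ρ.im := by simp
  by_cases hreg : 1 - c / (Real.log ((2 ^ j : ℕ) : ℝ) + Real.log (|(1 - ρ).im| + 4)) < (1 - ρ).re
  · obtain ⟨hq2, him⟩ := hZ (2 ^ j) χ⁻¹ hne' (1 - ρ) h1ρ hreg
    -- a real zero `1 - Re ρ` of the quadratic character `χ⁻¹`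
    have him' : ρ.im = 0 := by rw [him1] at him; linarith
    have hreal : χ⁻¹.LFunction ((1 - ρ.re : ℝ) : ℂ) = 0 := by
      have h2 : (1 : ℂ) - ρ = ((1 - ρ.re : ℝ) : ℂ) := by
        apply Complex.ext <;> simp [him']
      rw [← h2]; exact h1ρ
    have hb := hR j χ⁻¹ hne' (1 - ρ.re) hreal
    have h2 : min c κ / (Real.log ((2 : ℝ) ^ j) + Real.log (|ρ.im| + 4)) ≤
        κ / (Real.log ((2 : ℝ) ^ j) + Real.log 4) :=
      calc min c κ / (Real.log ((2 : ℝ) ^ j) + Real.log (|ρ.im| + 4))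
          ≤ κ / (Real.log ((2 : ℝ) ^ j) + Real.log (|ρ.im| + 4)) :=
            div_le_div_of_nonneg_right (min_le_right _ _) hL0.le
        _ ≤ κ / (Real.log ((2 : ℝ) ^ j) + Real.log 4) :=
            div_le_div_of_nonneg_left hκ.le (by linarith) (by linarith)
    linarith
  · rw [not_lt, hre1, him1, abs_neg, hcast] at hreg
    have h2 : min c κ / (Real.log ((2 : ℝ) ^ j) + Real.log (|ρ.im| + 4)) ≤
        c / (Real.log ((2 : ℝ) ^ j) + Real.log (|ρ.im| + 4)) :=
      div_le_div_of_nonneg_right (min_le_left _ _) hL0.le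
    linarith

/-- Numerics of the level `T = j³`: for `j ≥ 2`, `log j ≤ j log 2`, `log(j³ + 5) ≤ 5 j log 2`, hence
`log 2^j + log(j³ + 5) ≤ 6 j log 2`. [folklore] -/
theorem log_cube_add_five_le {j : ℕ} (hj : 2 ≤ j) :
    Real.log (j : ℝ) ≤ j * Real.log 2 ∧ Real.log ((j : ℝ) ^ 3 + 5) ≤ 5 * j * Real.log 2 ∧
      Real.log ((2 : ℝ) ^ j) + Real.log ((j : ℝ) ^ 3 + 5) ≤ 6 * j * Real.log 2 := by
  have hlog2 := Real.log_two_gt_d9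
  have hj' : (2 : ℝ) ≤ j := by exact_mod_cast hj
  have hj0 : (0 : ℝ) < j := by linarith
  have h1 : Real.log (j : ℝ) ≤ j * Real.log 2 := by
    have h := Nat.lt_two_pow_self (n := j)
    have h' : (j : ℝ) ≤ (2 : ℝ) ^ j := by exact_mod_cast h.le
    calc Real.log (j : ℝ) ≤ Real.log ((2 : ℝ) ^ j) := Real.log_le_log hj0 h'
      _ = j * Real.log 2 := by rw [Real.log_pow]
  have h2 : Real.log ((j : ℝ) ^ 3 + 5) ≤ 5 * j * Real.log 2 := by
    have h6 : (j : ℝ) ^ 3 + 5 ≤ 6 * (j : ℝ) ^ 3 := by nlinarith [pow_le_pow_left₀ (by norm_num : (0:ℝ) ≤ 2) hj' 3]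
    calc Real.log ((j : ℝ) ^ 3 + 5) ≤ Real.log (6 * (j : ℝ) ^ 3) := Real.log_le_log (by positivity) h6
      _ = Real.log 6 + 3 * Real.log j := by
          rw [Real.log_mul (by norm_num) (by positivity), Real.log_pow]; norm_num
      _ ≤ 2 + 3 * (j * Real.log 2) := by linarith [Literature.NumberTheory.Sieve.CubicSieve.log_six_le_two]
      _ ≤ 5 * j * Real.log 2 := by nlinarith
  refine ⟨h1, h2, ?_⟩
  rw [Real.log_pow]
  linarith

/-- **The zero sum between two points**: if every non-trivial zero of the box has `Re ρ ≥ β₀ > 0` and `x^{Re ρ} ≤ M`, then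
`‖Σ_{|γ|≤T} m(ρ)(x^ρ − y^ρ)/ρ‖ ≤ (2M/β₀) Σ m(ρ)` for `1 ≤ y ≤ x` (`|x^ρ − y^ρ| ≤ 2 x^{Re ρ}`, `|ρ| ≥ Re ρ`). [folklore] -/
theorem norm_charZeroSumTrunc_sub_le {q : ℕ} [NeZero q] {χ : DirichletCharacter ℂ q} (hχ : χ ≠ 1)
    {x y T M β₀ : ℝ} (hy : 1 ≤ y) (hyx : y ≤ x) (hβ₀ : 0 < β₀) (hM : 0 ≤ M)
    (hzeros : ∀ ρ ∈ (lfunctionZeroBox_finite hχ T).toFinset, β₀ ≤ ρ.re ∧ x ^ ρ.re ≤ M) :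
    ‖charZeroSumTrunc χ x T - charZeroSumTrunc χ y T‖ ≤
      2 * M / β₀ * ∑ ρ ∈ (lfunctionZeroBox_finite hχ T).toFinset, (DirichletDisc.zeroOrder χ ρ : ℝ) := by
  classical
  have hx0 : 0 < x := by linarith
  have hy0 : 0 < y := by linarith
  rw [charZeroSumTrunc_eq hχ, charZeroSumTrunc_eq hχ, ← Finset.sum_sub_distrib, Finset.mul_sum]
  refine (norm_sum_le _ _).trans (Finset.sum_le_sum fun ρ hρ => ?_)
  obtain ⟨hβ, hxM⟩ := hzeros ρ hρ
  have hre0 : 0 < ρ.re := lt_of_lt_of_le hβ₀ hβ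
  have hρ0 : β₀ ≤ ‖ρ‖ := hβ.trans ((le_abs_self _).trans (Complex.abs_re_le_norm ρ))
  rw [← mul_sub, ← sub_div, norm_mul, Complex.norm_natCast, norm_div]
  have hnum : ‖(x : ℂ) ^ ρ - (y : ℂ) ^ ρ‖ ≤ 2 * M := by
    calc ‖(x : ℂ) ^ ρ - (y : ℂ) ^ ρ‖ ≤ ‖(x : ℂ) ^ ρ‖ + ‖(y : ℂ) ^ ρ‖ := norm_sub_le _ _
      _ = x ^ ρ.re + y ^ ρ.re := by
          rw [Complex.norm_cpow_eq_rpow_re_of_pos hx0, Complex.norm_cpow_eq_rpow_re_of_pos hy0]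
      _ ≤ x ^ ρ.re + x ^ ρ.re := by
          have : y ^ ρ.re ≤ x ^ ρ.re := Real.rpow_le_rpow hy0.le hyx hre0.le
          linarith
      _ ≤ 2 * M := by linarith
  have hm0 : (0 : ℝ) ≤ DirichletDisc.zeroOrder χ ρ := Nat.cast_nonneg _
  calc (DirichletDisc.zeroOrder χ ρ : ℝ) * (‖(x : ℂ) ^ ρ - (y : ℂ) ^ ρ‖ / ‖ρ‖)
      ≤ (DirichletDisc.zeroOrder χ ρ : ℝ) * (2 * M / β₀) :=
        mul_le_mul_of_nonneg_left (div_le_div₀ (by positivity) hnum hβ₀ hρ0) hm0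
    _ = 2 * M / β₀ * (DirichletDisc.zeroOrder χ ρ : ℝ) := mul_comm _ _

/-- The primes `≤ t` split as those `≤ 2` and those in `(2, t]` (`t ≥ 2`). [folklore] -/
theorem sum_primes_Iic_split (f : ℕ → ℂ) {t : ℕ} (ht : 2 ≤ t) :
    ∑ p ∈ (Finset.Iic t).filter Nat.Prime, f p =
      ∑ p ∈ (Finset.Iic 2).filter Nat.Prime, f p + ∑ p ∈ (Finset.Ioc 2 t).filter Nat.Prime, f p := by
  have hsplit : (Finset.Iic t).filter Nat.Prime =
      ((Finset.Iic 2).filter Nat.Prime) ∪ ((Finset.Ioc 2 t).filter Nat.Prime) := by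
    rw [← Finset.filter_union]
    congr 1
    ext n
    simp only [Finset.mem_union, Finset.mem_Iic, Finset.mem_Ioc]
    omega
  have hdisj : Disjoint ((Finset.Iic 2).filter Nat.Prime) ((Finset.Ioc 2 t).filter Nat.Prime) := by
    rw [Finset.disjoint_left]
    intro n h1 h2
    simp only [Finset.mem_filter, Finset.mem_Iic, Finset.mem_Ioc] at h1 h2
    omega
  rw [hsplit, Finset.sum_union hdisj]

end Summit.ValiantsHypothesis.ValiantsHypothesis.Theorems.LiouvilleSarnak.AlignedTypeI.CharactersModTwoN
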